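import Literature.Analysis.FluidPDE.PineauVicolCylinderRegularity
import Literature.Analysis.FluidPDE.TsaiLocalPressureSup

/-!
# Crux `SymmetricScarExists` (stmt-NavierStokesRegularity-11718), line `logtime-bernoulli-certificate`:
# stub `stub_apexScaleInvariantBounds` — the Riesz pressure, I: source bounds, the near potential,
# and a far-field dominator (registered sub-goal `apexRieszPressure_nearBounds`)

Helper file (`--supports stmt-NavierStokesRegularity-11718`; theorems only, no definitions, no named
facts).  The pressure half of the stub `stub_apexScaleInvariantBounds` (isolated by the landed
`stub_apexScaleInvariantBounds_ofPressure`) asks for scale-invariant pointwise bounds on the Riesz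
pressure `Q[v(t)] = RᵢRⱼ(vᵢvⱼ)` of a classical Type-I solution, i.e. on the tree's pressure potential
`pressurePotential w = −Q₁[w] − Q₂[w]` (`PressureRepresentation.lean`: near part
`Q₁[w](x) = ∫ Γ₀(z) G[w](x − z) dz`, `G[w] = ∂ᵢ∂ⱼ(wᵢwⱼ)` the quadratic source, `Γ₀` the truncated
Newtonian kernel; far part `Q₂[w](x) = ∫ D²Γ∞(x − y)(w y, w y) dy`).  No Calderón–Zygmund theory is
needed once the DERIVATIVES of the velocity are controlled (they are, by the tree's
`PineauVicol2026.exists_forall_iteratedFDeriv_le_of_typeI`): this file provides the three elementary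
inputs, all at the fixed cutoff scale `(1, 2)`.

* `norm_iteratedFDeriv_pressureSource_le` — Leibniz bounds for the source:
  `‖DᵏG[w](y)‖ ≤ T(1+T) 2^{k+1} B²` if `‖Dʲw(y)‖ ≤ B` for `j ≤ k + 2` (`T = ‖tr‖`; `G = tr ∘ D(Dw[w] + (div w) w)`,
  Mathlib's `norm_iteratedFDeriv_clm_apply` / `norm_iteratedFDeriv_smul_le`);
* `apexRieszPressure_nearBounds` (registered sub-goal) — `|Q₁[w](x)|, ‖DQ₁[w](x)‖, ‖D²Q₁[w](x)‖ ≤ N₁ · S`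
  when `G[w]`, `DG[w]`, `D²G[w]` are bounded by `S` on `B(x, 2)` (`N₁ = ∫|Γ₀|`; differentiation under
  the integral sign, `fderiv_integral_smul_comp_sub`);
* `exists_dominator_far` — for a kernel `Ψ` with `‖Ψ(z)‖ ≤ M/(1+|z|)³` and a near-singular Type-I
  profile `‖v(y)‖ ≤ C₀/(‖y‖ + s₀)`, `s₀ > 0`, the far integrand `‖Ψ(x − y)‖ ‖v y‖²` at points `‖x‖ ≤ 16` is
  dominated a.e. by an integrable function of integral `≤ M K_far C₀²` (near the vertex `‖v‖² ≤ C₀²/‖y‖²`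
  is locally integrable in dimension three; far away the kernel gives `(1+‖y‖)⁻⁵`), uniformly in `s₀`.

The far potential and its derivatives, the unit-scale and the scale-invariant bounds are in the sequel
files `…ApexRieszPressureUnitScale.lean`, `…ApexRieszPressureBounds.lean`.

## References

* B. Pineau, V. Vicol, arXiv:2607.09619 (2026), Lemma 2.1, Lemma 7.1. [PineauVicol2026]
* D. Gilbarg, N. S. Trudinger, *Elliptic PDE of Second Order* (2001), Lemma 4.1–4.2. [GilbargTrudinger2001]
* G. Seregin, V. Šverák, Comm. PDE 34 (2009) = arXiv:0804.1803, §2 p. 8. [SereginSverak2009]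
-/

noncomputable section

open MeasureTheory Set Function Filter Topology Metric
open scoped ContDiff

namespace Summit.NavierStokesRegularity.NavierStokesRegularity.Theorems.SymmetricScarExists.LogtimeBernoulli

open Literature.Analysis.FluidPDE
open Literature.Analysis.FluidPDE.FourierNS (HasDecay)
open Literature.Analysis.FluidPDE.PineauVicol2026 (newtonNearMass newtonNearMass_nonneg
  integral_closedBall_indicator_norm_sub_inv_sq_le integrable_inv_one_add_norm_pow_five)

-- nested operator types `ℝ³ →L[ℝ] ℝ³ →L[ℝ] ℝ³ →L[ℝ] ℝ`
set_option maxSynthPendingDepth 3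

/-! ### The quadratic source: Leibniz bounds -/

/-- `Σᵢ C(m,i) aᵢ bᵢ ≤ 2ᵐ B²` when `0 ≤ aᵢ, bᵢ ≤ B` (`Σᵢ C(m,i) = 2ᵐ`). [folklore] -/
theorem sum_choose_mul_le {m : ℕ} {a b : ℕ → ℝ} {B : ℝ} (hB : 0 ≤ B)
    (hb0 : ∀ i, 0 ≤ b i)
    (ha : ∀ i ∈ Finset.range (m + 1), a i ≤ B) (hb : ∀ i ∈ Finset.range (m + 1), b i ≤ B) :
    ∑ i ∈ Finset.range (m + 1), (m.choose i : ℝ) * a i * b i ≤ 2 ^ m * B ^ 2 := by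
  have hsum : ∑ i ∈ Finset.range (m + 1), (m.choose i : ℝ) = 2 ^ m := by
    have := Nat.sum_range_choose m
    exact_mod_cast this
  calc ∑ i ∈ Finset.range (m + 1), (m.choose i : ℝ) * a i * b i
      ≤ ∑ i ∈ Finset.range (m + 1), (m.choose i : ℝ) * B * B :=
        Finset.sum_le_sum fun i hi =>
          mul_le_mul (mul_le_mul_of_nonneg_left (ha i hi) (Nat.cast_nonneg _)) (hb i hi) (hb0 i)
            (mul_nonneg (Nat.cast_nonneg _) hB)
    _ = (∑ i ∈ Finset.range (m + 1), (m.choose i : ℝ)) * B * B := by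
        rw [Finset.sum_mul, Finset.sum_mul]
    _ = 2 ^ m * B ^ 2 := by rw [hsum]; ring

/-- **Leibniz bounds for the quadratic source** `G[w] = ∂ᵢ∂ⱼ(wᵢwⱼ) = div(Dw[w] + (div w) w)`:
if `‖Dʲw(y)‖ ≤ B` for all `j ≤ k + 2` then `‖DᵏG[w](y)‖ ≤ T (1+T) 2^{k+1} B²`, `T = ‖tr‖`
(`DᵏG = tr ∘ D^{k+1}(Dw[w] + (div w) w)`, `div w = tr ∘ Dw`, and Mathlib's Leibniz bounds
`norm_iteratedFDeriv_clm_apply`, `norm_iteratedFDeriv_smul_le`). [folklore] -/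
theorem norm_iteratedFDeriv_pressureSource_le {w : (EuclideanSpace ℝ (Fin 3)) → (EuclideanSpace ℝ (Fin 3))}
    (hw : ContDiff ℝ ∞ w) (k : ℕ) {B : ℝ} (hB0 : 0 ≤ B) (y : EuclideanSpace ℝ (Fin 3))
    (hB : ∀ j ≤ k + 2, ‖iteratedFDeriv ℝ j w y‖ ≤ B) :
    ‖iteratedFDeriv ℝ k (pressureSource w) y‖ ≤
      ‖(traceCLM : ((EuclideanSpace ℝ (Fin 3)) →L[ℝ] (EuclideanSpace ℝ (Fin 3))) →L[ℝ] ℝ)‖ *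
        ((1 + ‖(traceCLM : ((EuclideanSpace ℝ (Fin 3)) →L[ℝ] (EuclideanSpace ℝ (Fin 3))) →L[ℝ] ℝ)‖) *
          (2 ^ (k + 1) * B ^ 2)) := by
  set T : ℝ := ‖(traceCLM : ((EuclideanSpace ℝ (Fin 3)) →L[ℝ] (EuclideanSpace ℝ (Fin 3))) →L[ℝ] ℝ)‖
    with hT
  have hT0 : 0 ≤ T := norm_nonneg _
  have hDw : ContDiff ℝ ∞ (fderiv ℝ w) := hw.fderiv_right (m := ∞) le_rfl
  have hdiv : ContDiff ℝ ∞ (VectorCalculus.divergence w) := by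
    rw [divergence_eq_traceCLM_comp]; exact traceCLM.contDiff.comp hDw
  have hconv : ContDiff ℝ ∞ (convect w w) := by
    have e : convect w w = fun y => (fderiv ℝ w y) (w y) := rfl
    rw [e]; exact hDw.clm_apply hw
  have hsm : ContDiff ℝ ∞ (fun y => VectorCalculus.divergence w y • w y) := hdiv.smul hw
  set W : (EuclideanSpace ℝ (Fin 3)) → (EuclideanSpace ℝ (Fin 3)) :=
    convect w w + fun y => VectorCalculus.divergence w y • w y with hW
  have hWs : ContDiff ℝ ∞ W := hconv.add hsm
  have hG : pressureSource w = traceCLM ∘ fderiv ℝ W := by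
    rw [pressureSource_def, divergence_eq_traceCLM_comp]
    rfl
  -- derivative bounds of `w` in the needed ranges
  have hDj : ∀ i ∈ Finset.range (k + 2), ‖iteratedFDeriv ℝ i (fderiv ℝ w) y‖ ≤ B := by
    intro i hi
    rw [norm_iteratedFDeriv_fderiv]
    exact hB (i + 1) (by have := Finset.mem_range.1 hi; omega)
  have hwj : ∀ i ∈ Finset.range (k + 2), ‖iteratedFDeriv ℝ (k + 1 - i) w y‖ ≤ B := by
    intro i hi
    exact hB (k + 1 - i) (by omega)
  have hdivj : ∀ i ∈ Finset.range (k + 2), ‖iteratedFDeriv ℝ i (VectorCalculus.divergence w) y‖ ≤ T * B := by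
    intro i hi
    rw [divergence_eq_traceCLM_comp]
    calc ‖iteratedFDeriv ℝ i (traceCLM ∘ fderiv ℝ w) y‖ ≤ T * ‖iteratedFDeriv ℝ i (fderiv ℝ w) y‖ :=
          ContinuousLinearMap.norm_iteratedFDeriv_comp_left _ hDw.contDiffAt (by exact_mod_cast le_top)
      _ ≤ T * B := mul_le_mul_of_nonneg_left (hDj i hi) hT0
  -- (a) the convective term
  have ha : ‖iteratedFDeriv ℝ (k + 1) (convect w w) y‖ ≤ 2 ^ (k + 1) * B ^ 2 := by
    have e : convect w w = fun y => (fderiv ℝ w y) (w y) := rfl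
    rw [e]
    refine (norm_iteratedFDeriv_clm_apply hDw hw y (by exact_mod_cast le_top)).trans ?_
    exact sum_choose_mul_le hB0 (fun _ => norm_nonneg _) hDj hwj
  -- (b) the compressible term
  have hb : ‖iteratedFDeriv ℝ (k + 1) (fun y => VectorCalculus.divergence w y • w y) y‖ ≤
      2 ^ (k + 1) * (T * B) * B := by
    refine (norm_iteratedFDeriv_smul_le hdiv hw y (by exact_mod_cast le_top)).trans ?_
    have hTB : 0 ≤ T * B := mul_nonneg hT0 hB0
    have hmax : ∀ i ∈ Finset.range (k + 2), ‖iteratedFDeriv ℝ (k + 1 - i) w y‖ ≤ max (T * B) B :=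
      fun i hi => (hwj i hi).trans (le_max_right _ _)
    have hmax' : ∀ i ∈ Finset.range (k + 2),
        ‖iteratedFDeriv ℝ i (VectorCalculus.divergence w) y‖ ≤ max (T * B) B :=
      fun i hi => (hdivj i hi).trans (le_max_left _ _)
    calc ∑ i ∈ Finset.range (k + 1 + 1), ((k + 1).choose i : ℝ) *
          ‖iteratedFDeriv ℝ i (VectorCalculus.divergence w) y‖ * ‖iteratedFDeriv ℝ (k + 1 - i) w y‖
        ≤ ∑ i ∈ Finset.range (k + 1 + 1), ((k + 1).choose i : ℝ) * (T * B) * B :=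
          Finset.sum_le_sum fun i hi =>
            mul_le_mul (mul_le_mul_of_nonneg_left (hdivj i hi) (Nat.cast_nonneg _)) (hwj i hi)
              (norm_nonneg _) (mul_nonneg (Nat.cast_nonneg _) hTB)
      _ = (∑ i ∈ Finset.range (k + 1 + 1), ((k + 1).choose i : ℝ)) * (T * B) * B := by
          rw [Finset.sum_mul, Finset.sum_mul]
      _ = 2 ^ (k + 1) * (T * B) * B := by
          have hsum : ∑ i ∈ Finset.range (k + 1 + 1), ((k + 1).choose i : ℝ) = 2 ^ (k + 1) := by
            have := Nat.sum_range_choose (k + 1)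
            exact_mod_cast this
          rw [hsum]
  -- assemble
  have hWk : ‖iteratedFDeriv ℝ (k + 1) W y‖ ≤ 2 ^ (k + 1) * B ^ 2 + 2 ^ (k + 1) * (T * B) * B := by
    rw [hW, iteratedFDeriv_add_apply (hconv.of_le (by exact_mod_cast le_top)).contDiffAt
      (hsm.of_le (by exact_mod_cast le_top)).contDiffAt]
    exact (norm_add_le _ _).trans (add_le_add ha hb)
  rw [hG]
  calc ‖iteratedFDeriv ℝ k (traceCLM ∘ fderiv ℝ W) y‖ ≤ T * ‖iteratedFDeriv ℝ k (fderiv ℝ W) y‖ :=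
        ContinuousLinearMap.norm_iteratedFDeriv_comp_left _
          (hWs.fderiv_right (m := ∞) le_rfl).contDiffAt (by exact_mod_cast le_top)
    _ = T * ‖iteratedFDeriv ℝ (k + 1) W y‖ := by rw [norm_iteratedFDeriv_fderiv]
    _ ≤ T * (2 ^ (k + 1) * B ^ 2 + 2 ^ (k + 1) * (T * B) * B) := mul_le_mul_of_nonneg_left hWk hT0
    _ = T * ((1 + T) * (2 ^ (k + 1) * B ^ 2)) := by ring

/-! ### The near potential: sup bounds through the source -/

/-- **The truncated Newtonian kernel against a locally bounded function**:
`‖∫ Γ₀(z) • Φ(x − z) dz‖ ≤ N₁ · S` if `‖Φ(x − z)‖ ≤ S` for `‖z‖ ≤ 2` (`Γ₀ = Γ₀^{1,2}` vanishes off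
`B̄(0,2)`, `N₁ = ∫|Γ₀|`). [folklore] -/
theorem norm_integral_newtonNear_smul_le {F : Type*} [NormedAddCommGroup F] [NormedSpace ℝ F]
    {Φ : (EuclideanSpace ℝ (Fin 3)) → F} {S : ℝ} (x : EuclideanSpace ℝ (Fin 3))
    (hb : ∀ z : EuclideanSpace ℝ (Fin 3), ‖z‖ ≤ 2 → ‖Φ (x - z)‖ ≤ S) :
    ‖∫ z, newtonNear (1 : ℝ) 2 z • Φ (x - z)‖ ≤ newtonNearMass * S := by
  have hint : Integrable fun z : EuclideanSpace ℝ (Fin 3) => |newtonNear (1 : ℝ) 2 z| * S :=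
    (integrable_newtonNear zero_le_one one_lt_two).abs.mul_const S
  calc ‖∫ z, newtonNear (1 : ℝ) 2 z • Φ (x - z)‖ ≤ ∫ z, |newtonNear (1 : ℝ) 2 z| * S := by
        refine norm_integral_le_of_norm_le hint (Eventually.of_forall fun z => ?_)
        rw [norm_smul, Real.norm_eq_abs]
        by_cases hz : ‖z‖ ≤ 2
        · exact mul_le_mul_of_nonneg_left (hb z hz) (abs_nonneg _)
        · rw [newtonNear_eq_zero zero_le_one one_lt_two (not_le.1 hz).le, abs_zero, zero_mul,
            zero_mul]
    _ = newtonNearMass * S := by rw [integral_mul_const]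

/-- **Registered sub-goal `apexRieszPressure_nearBounds`: sup bounds for the near potential and its
first two derivatives through the source.**  For a smooth field `w`, if the quadratic source
`G[w] = ∂ᵢ∂ⱼ(wᵢwⱼ)` and its first two derivatives are bounded by `S₀, S₁, S₂` on the ball `B(x, 2)`,
then `|Q₁[w](x)| ≤ N₁S₀`, `‖DQ₁[w](x)‖ ≤ N₁S₁`, `‖D²Q₁[w](x)‖ ≤ N₁S₂` for the near potential
`Q₁[w](x) = ∫ Γ₀(z) G[w](x − z) dz` (`N₁ = ∫|Γ₀^{1,2}|`; differentiation under the integral sign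
against the compactly supported `L¹` kernel, `fderiv_integral_smul_comp_sub`, twice).
[cite: GilbargTrudinger2001, Lemma 4.1] -/
theorem apexRieszPressure_nearBounds :
    ∀ (w : EuclideanSpace ℝ (Fin 3) → EuclideanSpace ℝ (Fin 3)), ContDiff ℝ ∞ w → ∀ (x : EuclideanSpace ℝ (Fin 3)) (S₀ S₁ S₂ : ℝ), (∀ (z : EuclideanSpace ℝ (Fin 3)), ‖z‖ ≤ 2 → ‖Literature.Analysis.FluidPDE.pressureSource w (x - z)‖ ≤ S₀) → (∀ (z : EuclideanSpace ℝ (Fin 3)), ‖z‖ ≤ 2 → ‖fderiv ℝ (Literature.Analysis.FluidPDE.pressureSource w) (x - z)‖ ≤ S₁) → (∀ (z : EuclideanSpace ℝ (Fin 3)), ‖z‖ ≤ 2 → ‖fderiv ℝ (fderiv ℝ (Literature.Analysis.FluidPDE.pressureSource w)) (x - z)‖ ≤ S₂) → |Literature.Analysis.FluidPDE.nearPotential 1 2 w x| ≤ Literature.Analysis.FluidPDE.PineauVicol2026.newtonNearMass * S₀ ∧ ‖fderiv ℝ (Literature.Analysis.FluidPDE.nearPotential 1 2 w) x‖ ≤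 Literature.Analysis.FluidPDE.PineauVicol2026.newtonNearMass * S₁ ∧ ‖iteratedFDeriv ℝ 2 (Literature.Analysis.FluidPDE.nearPotential 1 2 w) x‖ ≤ Literature.Analysis.FluidPDE.PineauVicol2026.newtonNearMass * S₂ := by
  intro w hw x S₀ S₁ S₂ hG0 hG1 hG2
  set G := pressureSource w with hGdef
  have hw4 : ContDiff ℝ 4 w := hw.of_le (by norm_cast)
  have hG2c : ContDiff ℝ 2 G := contDiff_pressureSource (by exact_mod_cast hw4)
  have hG1c : ContDiff ℝ 1 G := hG2c.of_le one_le_two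
  have hDG1 : ContDiff ℝ 1 (fderiv ℝ G) := hG2c.fderiv_right (m := 1) le_rfl
  have hk : Integrable (newtonNear (1 : ℝ) 2) := integrable_newtonNear zero_le_one one_lt_two
  have hkρ : ∀ z : EuclideanSpace ℝ (Fin 3), 2 < ‖z‖ → newtonNear (1 : ℝ) 2 z = 0 := fun z hz =>
    newtonNear_eq_zero zero_le_one one_lt_two hz.le
  have e0 : nearPotential 1 2 w = fun x => ∫ z, newtonNear (1 : ℝ) 2 z • G (x - z) := by
    funext x; simp only [nearPotential, smul_eq_mul, hGdef]
  have e1 : fderiv ℝ (nearPotential 1 2 w) = fun x => ∫ z, newtonNear (1 : ℝ) 2 z • fderiv ℝ G (x - z) := by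
    funext x; rw [e0]; exact fderiv_integral_smul_comp_sub hk hkρ hG1c x
  have e2 : fderiv ℝ (fderiv ℝ (nearPotential 1 2 w)) x =
      ∫ z, newtonNear (1 : ℝ) 2 z • fderiv ℝ (fderiv ℝ G) (x - z) := by
    rw [e1]; exact fderiv_integral_smul_comp_sub hk hkρ hDG1 x
  refine ⟨?_, ?_, ?_⟩
  · rw [← Real.norm_eq_abs, e0]
    exact norm_integral_newtonNear_smul_le x hG0
  · rw [e1]
    exact norm_integral_newtonNear_smul_le x hG1
  · have : ‖iteratedFDeriv ℝ 2 (nearPotential 1 2 w) x‖ = ‖fderiv ℝ (fderiv ℝ (nearPotential 1 2 w)) x‖ := by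
      rw [← norm_iteratedFDeriv_one (f := fderiv ℝ (nearPotential 1 2 w)), norm_iteratedFDeriv_fderiv]
    rw [this, e2]
    exact norm_integral_newtonNear_smul_le x hG2

/-! ### The far potential: a dominator for near-singular Type-I profiles -/

/-- **A far-field dominator for near-singular Type-I profiles.**  Let `‖Ψ(z)‖ ≤ M/(1+|z|)³`
(`HasDecay 3 M Ψ`: the far kernels `D²Γ∞, D³Γ∞, D⁴Γ∞`) and `‖v(y)‖ ≤ C₀/(‖y‖ + s₀)` with `s₀ > 0`
(a Type-I slice, parabolic vertex at the origin).  For `‖x‖ ≤ 16` the far integrand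
`y ↦ ‖Ψ(x − y)‖ ‖v y‖²` is dominated off the null set `{0}` by the integrable
`g = M C₀² 𝟙_{B̄(0,40)} ‖y‖⁻² + 256 M C₀² (1+‖y‖)⁻⁵` (inside: `‖Ψ‖ ≤ M`, `‖v‖² ≤ C₀²‖y‖⁻²`; outside:
`‖x − y‖ ≥ ‖y‖/2` so `‖Ψ(x−y)‖ ≤ 8M‖y‖⁻³`, and `‖y‖⁻⁵ ≤ 32(1+‖y‖)⁻⁵`), whose integral is at most
`M (3|B₁|·80 + 256 ∫(1+‖y‖)⁻⁵) C₀²` (`∫_{B̄(0,40)}‖y‖⁻² ≤ 3|B₁|·80`) — uniformly in `s₀`. [folklore] -/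
theorem exists_dominator_far {F : Type*} [NormedAddCommGroup F] {Ψ : (EuclideanSpace ℝ (Fin 3)) → F}
    {M : ℝ} (hΨ : HasDecay 3 M Ψ) {v : (EuclideanSpace ℝ (Fin 3)) → (EuclideanSpace ℝ (Fin 3))}
    {C₀ s₀ : ℝ} (hs₀ : 0 < s₀) (hv : ∀ y, ‖v y‖ ≤ C₀ / (‖y‖ + s₀)) {x : EuclideanSpace ℝ (Fin 3)}
    (hx : ‖x‖ ≤ 16) :
    ∃ g : (EuclideanSpace ℝ (Fin 3)) → ℝ, Integrable g ∧
      (∀ᵐ y ∂(volume : Measure (EuclideanSpace ℝ (Fin 3))), ‖Ψ (x - y)‖ * ‖v y‖ ^ 2 ≤ g y) ∧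
      ∫ y, g y ≤ M * (3 * (volume : Measure (EuclideanSpace ℝ (Fin 3))).real (ball 0 1) * 80 +
        256 * ∫ y : EuclideanSpace ℝ (Fin 3), ((1 + ‖y‖) ^ 5)⁻¹) * C₀ ^ 2 := by
  have hM : 0 ≤ M := hΨ.nonneg
  have hC : 0 ≤ C₀ := by
    have h := (norm_nonneg _).trans (hv 0)
    rw [norm_zero, zero_add] at h
    exact (div_nonneg_iff.1 h).elim (fun h => h.1) fun h => absurd h.2 (not_le.2 hs₀)
  set V₁ : ℝ := (volume : Measure (EuclideanSpace ℝ (Fin 3))).real (ball 0 1) with hV₁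
  set K₅ : ℝ := ∫ y : EuclideanSpace ℝ (Fin 3), ((1 + ‖y‖) ^ 5)⁻¹ with hK₅
  have hK₅0 : 0 ≤ K₅ := integral_nonneg fun y => by positivity
  set B : Set (EuclideanSpace ℝ (Fin 3)) := closedBall 0 40 with hB
  obtain ⟨hBi, hBint⟩ := integral_closedBall_indicator_norm_sub_inv_sq_le (0 : EuclideanSpace ℝ (Fin 3))
    (by norm_num : (0 : ℝ) < 40)
  set g : (EuclideanSpace ℝ (Fin 3)) → ℝ := fun y =>
    M * C₀ ^ 2 * B.indicator (fun y => (‖y - 0‖ ^ 2)⁻¹) y + 256 * M * C₀ ^ 2 * ((1 + ‖y‖) ^ 5)⁻¹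
    with hg
  have hgi : Integrable g := (hBi.const_mul _).add (integrable_inv_one_add_norm_pow_five.const_mul _)
  -- kernel and weight bounds
  have hΨM : ∀ z, ‖Ψ z‖ ≤ M := fun z => (hΨ z).trans
    (mul_le_of_le_one_right hM (inv_le_one_of_one_le₀ (one_le_pow₀ (by linarith [norm_nonneg z]))))
  have hvy : ∀ y : EuclideanSpace ℝ (Fin 3), y ≠ 0 → ‖v y‖ ^ 2 ≤ C₀ ^ 2 * (‖y‖ ^ 2)⁻¹ := by
    intro y hy
    have hpos : 0 < ‖y‖ := norm_pos_iff.2 hy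
    have h1 : ‖v y‖ ≤ C₀ / ‖y‖ := (hv y).trans (div_le_div_of_nonneg_left hC hpos (by linarith))
    calc ‖v y‖ ^ 2 ≤ (C₀ / ‖y‖) ^ 2 := pow_le_pow_left₀ (norm_nonneg _) h1 2
      _ = C₀ ^ 2 * (‖y‖ ^ 2)⁻¹ := by rw [div_pow, div_eq_mul_inv]
  have hpt : ∀ y : EuclideanSpace ℝ (Fin 3), y ≠ 0 → ‖Ψ (x - y)‖ * ‖v y‖ ^ 2 ≤ g y := by
    intro y hy0
    have hg1 : 0 ≤ M * C₀ ^ 2 * B.indicator (fun y => (‖y - 0‖ ^ 2)⁻¹) y :=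
      mul_nonneg (by positivity) (Set.indicator_nonneg (fun y _ => by positivity) y)
    have hg2 : 0 ≤ 256 * M * C₀ ^ 2 * ((1 + ‖y‖) ^ 5)⁻¹ := by positivity
    by_cases hyB : y ∈ B
    · have h1 : ‖Ψ (x - y)‖ * ‖v y‖ ^ 2 ≤ M * (C₀ ^ 2 * (‖y‖ ^ 2)⁻¹) :=
        mul_le_mul (hΨM _) (hvy y hy0) (sq_nonneg _) hM
      have hgy : M * C₀ ^ 2 * B.indicator (fun y => (‖y - 0‖ ^ 2)⁻¹) y = M * (C₀ ^ 2 * (‖y‖ ^ 2)⁻¹) := by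
        rw [Set.indicator_of_mem hyB, sub_zero]; ring
      rw [hg]; dsimp only
      linarith
    · have hy40 : 40 < ‖y‖ := by rwa [hB, mem_closedBall_zero_iff, not_le] at hyB
      have hxy : ‖y‖ / 2 ≤ ‖x - y‖ := by
        have := norm_sub_norm_le y x
        rw [norm_sub_rev] at this
        linarith
      have hxy0 : 0 < ‖x - y‖ := by linarith
      have hy0' : 0 < ‖y‖ := by linarith
      have hk : ‖Ψ (x - y)‖ ≤ 8 * M * (‖y‖ ^ 3)⁻¹ := by
        calc ‖Ψ (x - y)‖ ≤ M * ((1 + ‖x - y‖) ^ 3)⁻¹ := hΨ _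
          _ ≤ M * ((‖y‖ / 2) ^ 3)⁻¹ := by
              refine mul_le_mul_of_nonneg_left ?_ hM
              exact inv_anti₀ (by positivity) (pow_le_pow_left₀ (by positivity) (by linarith) 3)
          _ = 8 * M * (‖y‖ ^ 3)⁻¹ := by field_simp; ring
      have h5 : (‖y‖ ^ 5)⁻¹ ≤ 32 * ((1 + ‖y‖) ^ 5)⁻¹ := by
        have hle : (1 + ‖y‖) ^ 5 ≤ (2 * ‖y‖) ^ 5 := pow_le_pow_left₀ (by positivity) (by linarith) 5
        rw [show (32 : ℝ) * ((1 + ‖y‖) ^ 5)⁻¹ = ((1 + ‖y‖) ^ 5 / 32)⁻¹ by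
          rw [inv_div, div_eq_mul_inv, mul_comm]]
        exact inv_anti₀ (by positivity) (by nlinarith)
      calc ‖Ψ (x - y)‖ * ‖v y‖ ^ 2 ≤ (8 * M * (‖y‖ ^ 3)⁻¹) * (C₀ ^ 2 * (‖y‖ ^ 2)⁻¹) :=
            mul_le_mul hk (hvy y hy0) (sq_nonneg _) (by positivity)
        _ = 8 * M * C₀ ^ 2 * (‖y‖ ^ 5)⁻¹ := by field_simp
        _ ≤ 8 * M * C₀ ^ 2 * (32 * ((1 + ‖y‖) ^ 5)⁻¹) := mul_le_mul_of_nonneg_left h5 (by positivity)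
        _ = 256 * M * C₀ ^ 2 * ((1 + ‖y‖) ^ 5)⁻¹ := by ring
        _ ≤ g y := by rw [hg]; dsimp only; linarith
  have hae : ∀ᵐ y ∂(volume : Measure (EuclideanSpace ℝ (Fin 3))), ‖Ψ (x - y)‖ * ‖v y‖ ^ 2 ≤ g y := by
    have h0 : (volume : Measure (EuclideanSpace ℝ (Fin 3))) {0} = 0 := measure_singleton 0
    rw [ae_iff]
    refine measure_mono_null (fun y hy => ?_) h0
    by_contra hne
    exact hy (hpt y hne)
  refine ⟨g, hgi, hae, ?_⟩
  have hI1 : ∫ y, M * C₀ ^ 2 * B.indicator (fun y => (‖y - 0‖ ^ 2)⁻¹) y ≤ M * C₀ ^ 2 * (3 * V₁ * (2 * 40)) := by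
    rw [integral_const_mul]
    exact mul_le_mul_of_nonneg_left hBint (by positivity)
  have hI2 : ∫ y : EuclideanSpace ℝ (Fin 3), 256 * M * C₀ ^ 2 * ((1 + ‖y‖) ^ 5)⁻¹ = 256 * M * C₀ ^ 2 * K₅ := by
    rw [integral_const_mul]
  calc ∫ y, g y = (∫ y, M * C₀ ^ 2 * B.indicator (fun y => (‖y - 0‖ ^ 2)⁻¹) y) +
        ∫ y : EuclideanSpace ℝ (Fin 3), 256 * M * C₀ ^ 2 * ((1 + ‖y‖) ^ 5)⁻¹ := by
        rw [hg]; dsimp only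
        rw [integral_add (hBi.const_mul _) (integrable_inv_one_add_norm_pow_five.const_mul _)]
    _ ≤ M * C₀ ^ 2 * (3 * V₁ * (2 * 40)) + 256 * M * C₀ ^ 2 * K₅ := by rw [hI2]; exact add_le_add hI1 le_rfl
    _ = M * (3 * V₁ * 80 + 256 * K₅) * C₀ ^ 2 := by ring

/-- The far-field constant `3|B₁|·80 + 256 ∫(1+‖y‖)⁻⁵` is nonnegative. [folklore] -/
theorem farConst_nonneg : 0 ≤ (3 * (volume : Measure (EuclideanSpace ℝ (Fin 3))).real (ball 0 1) * 80 +
        256 * ∫ y : EuclideanSpace ℝ (Fin 3), ((1 + ‖y‖) ^ 5)⁻¹) := by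
  have : 0 ≤ ∫ y : EuclideanSpace ℝ (Fin 3), ((1 + ‖y‖) ^ 5)⁻¹ := integral_nonneg fun y => by positivity
  have : 0 ≤ (volume : Measure (EuclideanSpace ℝ (Fin 3))).real (ball 0 1) := measureReal_nonneg
  positivity

/-- `‖∫ f‖ ≤ ∫ g` when `‖f(y)‖ ≤ ‖Ψ(x − y)‖ ‖v y‖²` pointwise and the latter is a.e. dominated by the
integrable `g` (the form in which `exists_dominator_far` is consumed). [folklore] -/
theorem norm_integral_le_of_dominator {G : Type*} [NormedAddCommGroup G] [NormedSpace ℝ G]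
    {F : Type*} [NormedAddCommGroup F]
    {f : (EuclideanSpace ℝ (Fin 3)) → G} {Ψ : (EuclideanSpace ℝ (Fin 3)) → F}
    {v : (EuclideanSpace ℝ (Fin 3)) → (EuclideanSpace ℝ (Fin 3))} {x : EuclideanSpace ℝ (Fin 3)}
    {g : (EuclideanSpace ℝ (Fin 3)) → ℝ} (hgi : Integrable g)
    (hae : ∀ᵐ y ∂(volume : Measure (EuclideanSpace ℝ (Fin 3))), ‖Ψ (x - y)‖ * ‖v y‖ ^ 2 ≤ g y)
    (hf : ∀ y, ‖f y‖ ≤ ‖Ψ (x - y)‖ * ‖v y‖ ^ 2) :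
    ‖∫ y, f y‖ ≤ ∫ y, g y :=
  norm_integral_le_of_norm_le hgi (hae.mono fun y hy => (hf y).trans hy)

end Summit.NavierStokesRegularity.NavierStokesRegularity.Theorems.SymmetricScarExists.LogtimeBernoulli
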